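/-
Copyright (c) 2026 the pub-hodgecm-mathlib formalisation cell (harness21).  Prover seat hodgecm-mathlib-F0P2-p08 (g3), Track B «K2-LIT»,
#184♮ = hLiu418 = `stmt-HodgeConjecture-24832`; socket #41 `sig_K2LiuSiegelEisensteinContinuation`, KIND W, brick (x-a-int): the JOINT integrability letter `hint` of ★ (x-a)
ED. 4 `exists_kindW_eulerLetters_of_localLetters` ∕ ★ `hPart_of_letters` ∕ ★ «OfRecord ED. 3», from the archimedean and the per-place factor letters.
THEOREMS ONLY (no `def`, no `instance`, no notation, no named-fact hypothesis, no `sorry`).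
-/
import Summits.HodgeConjecture.HodgeConjecture.Theorems.K2LiuKindWFiniteLetterIntegrable   -- ★∕📤 (iii-fin-int) `hint_of_isLocalSiegelSection` (⊇ ★ (x-a) ED. 1–2 `kindWFinset`)
import Mathlib.MeasureTheory.Integral.Pi
import HarnessLib

/-!
# Crux `HLiu418`, socket #41, KIND W — brick (x-a-int) `K2LiuKindWJointIntegrable`: THE JOINT INTEGRABILITY LETTER `hint` OF ★ (x-a) ED. 4 FROM ITS FACTORS
# `(a, y) ↦ (conj ψ_S(ι_∞ a)·∏_v conj ψ_S(ι_v y_v)) · (F_∞(a)·∏_v F_v(y_v))` is `ν_∞ ⊗ ⊗_v ν_v`-integrable once `conj ψ·F_∞` and every `conj ψ·F_v` are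

Cell `hodgecm-mathlib`, crux item hLiu418 = `stmt-HodgeConjecture-24832` (helper lane `--supports … --as helper`, count-neutral), route of record
`HCCMUnconditional`; squad K2 ∕ K2Liu, road `K2_Liu`, socket #41, KIND W; KW desk of record F0P2-p08 (g3).  THE LETTER PAID: the binder `hint` of ★ p862880 (x-a) ED. 4
`K2LiuSiegelEisensteinKindWEulerLocalLetters.exists_kindW_eulerLetters_of_localLetters` (:108–123) = of ★ p862818 `hPart_of_letters` = of 📤 «OfRecord ED. 3»
`kindW_block_of_record_localLetters` — per skew index `S` (`det ↑S ≠ 0`), `h`, `s` (`n∕2 < re s`) and term `j`: the pure-tensor summand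
`p ↦ (conj ψ_S(ι_∞ p.1) · ∏_{v∈T} conj ψ_S(ι_v (p.2 v))) · (FinfT j S h s ((w_Δ)_∞·p.1·h_∞) · ∏_{v∈T} FvT j S h v s ((w_Δ)_v·(p.2 v)·h_v))`, `T = kindWFinset T₀ ↑S h`, is integrable
against `νinf T ⊗ ⊗_{v∈T} νv v`.  It is Fubini bookkeeping (Mathlib `Integrable.mul_prod`, `Integrable.fintype_prod_dep`, `Finset.prod_mul_distrib` — the integrability twin of ★
p862531 `integral_prod_pi_tensor`) over TWO factor letters: the archimedean one `hintArch` (by value: ★ Φ6b-1 `integrable_xiTwoIntegrand` at definite indices ∕ the LH4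
(iii-arch) lineage) and the per-place one (= ★ p863154 (T1)'s `hint`, ★-payable by 📤 (iii-fin-int) `hint_of_isLocalSiegelSection` for smooth local Siegel factors).
* §1 `integrable_tensor_prod_pi` — generic: `Integrable (φ·g) μ`, `∀ i, Integrable (ψᵢ·kᵢ) νᵢ` ⟹ `Integrable ((φ ⊗ ∏ψᵢ)·(g ⊗ ∏kᵢ)) (μ ⊗ ⊗ᵢ νᵢ)`.
* §2 **`hint_of_factorIntegrable`** — ★ ED. 4's binder `hint` VERBATIM at `n := 2` from `hintArch` + `hintLoc` (= (T1)'s bytes).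
* §3 **`hint_of_isLocalSiegelSection_joint`** — the same with `hintLoc` discharged by 📤 (iii-fin-int): residue = `hintArch` + the per-factor letters `hsec hsm` + `hχu`.
[KudlaRallis1994, §1] [Tan1999, §3] [Folland1995, §2.3].
HONEST LABEL.  Count-neutral helper; closes no socket by itself: `HC_CM` is proved only modulo the 7 printed citations (2 remaining named inputs:
hLiu418 = `stmt-HodgeConjecture-24832`, h413 = `stmt-HodgeConjecture-24833`) until rung 0 closes.

## References
* [KudlaRallis1994] S. Kudla, S. Rallis, Ann. of Math. 140 (1994): §1.   * [Tan1999] V. Tan, Canad. J. Math. 51 (1999): §3.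
* [Folland1995] G. Folland, *A Course in Abstract Harmonic Analysis* (1995): §2.3 (Fubini–Tonelli on product Haar measures).
-/

set_option autoImplicit false
-- the mandated namespace repeats the single-problem summit's segment (`HodgeConjecture.HodgeConjecture`)
set_option linter.dupNamespace false

noncomputable section

open scoped Matrix ComplexConjugate NNReal ENNReal BigOperators
open NumberField IsDedekindDomain Matrix MeasureTheory Measure Set
open Literature.NumberTheory.Automorphic Literature.NumberTheory.Automorphic.UnitaryGroup Literature.NumberTheory.GaloisRepresentations
open Literature.NumberTheory.LFunctions
open Literature.NumberTheory.GelbartRogawski1991 Literature.NumberTheory.GelbartRogawski1991.GRConstruction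
open Literature.NumberTheory.GelbartRogawski1991.UnitaryDualPair
open Literature.NumberTheory.K2Lit Literature.NumberTheory.K2Lit.SiegelDoubled Literature.NumberTheory.K2Lit.LocalSiegelDoubled Literature.NumberTheory.K2Lit.PlaceSplitting
open Summit.HodgeConjecture.HodgeConjecture.Cruxes.HLiu418.K2LiuSiegelUnipotentFourierDefs
open Summit.HodgeConjecture.HodgeConjecture.Cruxes.HLiu418.K2LiuSiegelUnipotentLocalDefs
open Summit.HodgeConjecture.HodgeConjecture.Cruxes.HLiu418.K2LiuSiegelUnipotentSplitDefs
open Summit.HodgeConjecture.HodgeConjecture.Cruxes.HLiu418.K2LiuSiegelEisensteinKindWLetters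
open Summit.HodgeConjecture.HodgeConjecture.Cruxes.HLiu418.K2LiuKindWFiniteLetterIntegrable (hint_of_isLocalSiegelSection)

namespace Summit.HodgeConjecture.HodgeConjecture.Cruxes.HLiu418.K2LiuKindWJointIntegrable

/-! ## §1 Generic: a tensor of integrable factors is integrable on the product measure -/

section Generic

variable {X : Type*} [MeasurableSpace X] {ι : Type*} [Fintype ι] {Y : ι → Type*} [∀ i, MeasurableSpace (Y i)]
  (μ : Measure X) (ν : ∀ i, Measure (Y i)) [∀ i, SigmaFinite (ν i)]

/-- **a tensor integrand with integrable factors is integrable on `μ ⊗ ⊗ᵢ νᵢ`**: `(φ(x)·∏ᵢ ψᵢ(yᵢ))·(g(x)·∏ᵢ kᵢ(yᵢ)) = (φ·g)(x)·∏ᵢ (ψᵢ·kᵢ)(yᵢ)` and Mathlib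
`Integrable.mul_prod`, `Integrable.fintype_prod_dep`. [cite: Folland1995, §2.3] -/
theorem integrable_tensor_prod_pi (φ g : X → ℂ) (ψ k : ∀ i, Y i → ℂ)
    (hX : Integrable (fun x => φ x * g x) μ) (hY : ∀ i, Integrable (fun y => ψ i y * k i y) (ν i)) :
    Integrable (fun p : X × (∀ i, Y i) => (φ p.1 * ∏ i, ψ i (p.2 i)) * (g p.1 * ∏ i, k i (p.2 i))) (μ.prod (Measure.pi ν)) := by
  have hP : Integrable (fun y : ∀ i, Y i => ∏ i, (ψ i (y i) * k i (y i))) (Measure.pi ν) :=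
    Integrable.fintype_prod_dep (f := fun i y => ψ i y * k i y) hY
  refine (hX.mul_prod hP).congr (Filter.Eventually.of_forall fun p => ?_)
  show (φ p.1 * g p.1) * ∏ i, (ψ i (p.2 i) * k i (p.2 i)) = (φ p.1 * ∏ i, ψ i (p.2 i)) * (g p.1 * ∏ i, k i (p.2 i))
  rw [Finset.prod_mul_distrib]; ring

end Generic

/-! ## §2 The joint letter `hint` of ★ (x-a) ED. 4 from the two factor letters -/

section Head

variable (L : Type) [Field L] [NumberField L] [IsCMField L]
variable {N M : ℕ} (e : Fin N × Fin M ≃ Fin 2)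
  (dV : Fin N → L) (hdV : ∀ i, IsCMField.complexConj L (dV i) = dV i)
  (dW : Fin M → L) (hdW : ∀ i, IsCMField.complexConj L (dW i) = dW i)
  (hdV0 : ∀ i, dV i ≠ 0) (hdW0 : ∀ i, dW i ≠ 0)
  [MeasurableSpace ↥(unipDeltaArch L e dV hdV dW hdW)]
  [∀ v : HeightOneSpectrum (𝓞 (Fp L)), MeasurableSpace ↥(unipDeltaLoc L e dV hdV dW hdW v)]

set_option maxHeartbeats 400000 in -- MEASURED: 200 000 ✗ (`whnf` of the statement — ★ ED. 4's `FinfT FvT hint` telescope) ∕ 400 000 ✓; scoped 2×, term-mode proof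
/-- **THE JOINT LETTER `hint` OF ★ (x-a) ED. 4 (:108–123, `n := 2`) FROM ITS FACTORS.**  Inputs: the archimedean factor letter `hintArch` (per `(S,h,s,j)`: the twisted archimedean
summand `a ↦ conj ψ_S(ι_∞ a) · FinfT j S h s ((w_Δ)_∞·a·h_∞)` is `νinf (kindWFinset T₀ ↑S h)`-integrable on `{2∕2 < re s}`, `det ↑S ≠ 0`) and the per-place factor letter `hintLoc`
(★ p863154 (T1)'s binder `hint` VERBATIM; 📤 (iii-fin-int) pays it for smooth local Siegel factors).  THEN ★ ED. 4's `hint` VERBATIM (§1 at each `(S,h,s,j)`).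
[cite: KudlaRallis1994, §1] [cite: Tan1999, §3] [cite: Folland1995, §2.3] -/
theorem hint_of_factorIntegrable (T₀ : Finset (HeightOneSpectrum (𝓞 (Fp L))))
    (νinf : Finset (HeightOneSpectrum (𝓞 (Fp L))) → Measure ↥(unipDeltaArch L e dV hdV dW hdW))
    (νv : ∀ v : HeightOneSpectrum (𝓞 (Fp L)), Measure ↥(unipDeltaLoc L e dV hdV dW hdW v)) [∀ v, SigmaFinite (νv v)]
    {m : ℕ}
    (FinfT : Fin m → skewMatrices ((IsCMField.complexConj L : L ≃ₐ[Fp L] L) : L →+* L) ((gramR L e dV hdV dW hdW).map (algebraMap (Fp L) L)) → HA L e dV hdV dW hdW → ℂ →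
      UnitaryGroup.arch (Fp L) L (IsCMField.complexConj L) (2 + 2) (hermD L e dV hdV dW hdW) → ℂ)
    (FvT : Fin m → ∀ (S : skewMatrices ((IsCMField.complexConj L : L ≃ₐ[Fp L] L) : L →+* L) ((gramR L e dV hdV dW hdW).map (algebraMap (Fp L) L)))
      (h : HA L e dV hdV dW hdW) (v : (kindWFinset L e dV hdV dW hdW T₀ (S : Matrix (Fin 2) (Fin 2) L) h)),
      ℂ → UnitaryGroup.localPi L (IsCMField.complexConj L) (2 + 2) (hermD L e dV hdV dW hdW) v.1 → ℂ)
    (hintArch : ∀ (S : skewMatrices ((IsCMField.complexConj L : L ≃ₐ[Fp L] L) : L →+* L) ((gramR L e dV hdV dW hdW).map (algebraMap (Fp L) L))) (h : HA L e dV hdV dW hdW)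
      (s : ℂ) (j : Fin m), ((2 : ℕ) : ℝ) / 2 < s.re → (S : Matrix (Fin 2) (Fin 2) L).det ≠ 0 →
      Integrable (fun a : ↥(unipDeltaArch L e dV hdV dW hdW) =>
        conj (unipDeltaChar L e dV hdV dW hdW (S : Matrix (Fin 2) (Fin 2) L)
            (UnitaryGroup.archToAdelic (Fp L) L (IsCMField.complexConj L) (2 + 2) (hermD L e dV hdV dW hdW)
              (a : UnitaryGroup.arch (Fp L) L (IsCMField.complexConj L) (2 + 2) (hermD L e dV hdV dW hdW))) : ℂ) *
          FinfT j S h s (UnitaryGroup.archPart (Fp L) L (IsCMField.complexConj L) (2 + 2) (hermD L e dV hdV dW hdW) (SiegelDoubled.weylDelta L e dV hdV dW hdW) *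
              (a : UnitaryGroup.arch (Fp L) L (IsCMField.complexConj L) (2 + 2) (hermD L e dV hdV dW hdW)) *
              UnitaryGroup.archPart (Fp L) L (IsCMField.complexConj L) (2 + 2) (hermD L e dV hdV dW hdW) h))
        (νinf (kindWFinset L e dV hdV dW hdW T₀ (S : Matrix (Fin 2) (Fin 2) L) h)))
    (hintLoc : ∀ (j : Fin m) (S : skewMatrices ((IsCMField.complexConj L : L ≃ₐ[Fp L] L) : L →+* L) ((gramR L e dV hdV dW hdW).map (algebraMap (Fp L) L)))
      (h : HA L e dV hdV dW hdW) (v : (kindWFinset L e dV hdV dW hdW T₀ (S : Matrix (Fin 2) (Fin 2) L) h)) (s : ℂ), ((2 : ℕ) : ℝ) / 2 < s.re → (S : Matrix (Fin 2) (Fin 2) L).det ≠ 0 →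
      Integrable (fun y : ↥(unipDeltaLoc L e dV hdV dW hdW v.1) =>
        conj (unipDeltaChar L e dV hdV dW hdW (S : Matrix (Fin 2) (Fin 2) L)
            (locToAdelic L e dV hdV dW hdW v.1
              ((y : ↥(unipDeltaLoc L e dV hdV dW hdW v.1)) : UnitaryGroup.localPi L (IsCMField.complexConj L) (2 + 2) (hermD L e dV hdV dW hdW) v.1)) : ℂ) *
          FvT j S h v s (UnitaryGroup.evalPlace (Fp L) L (IsCMField.complexConj L) (2 + 2) (hermD L e dV hdV dW hdW) v.1
                (UnitaryGroup.finPart (Fp L) L (IsCMField.complexConj L) (2 + 2) (hermD L e dV hdV dW hdW) (SiegelDoubled.weylDelta L e dV hdV dW hdW)) *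
              ((y : ↥(unipDeltaLoc L e dV hdV dW hdW v.1)) : UnitaryGroup.localPi L (IsCMField.complexConj L) (2 + 2) (hermD L e dV hdV dW hdW) v.1) *
              UnitaryGroup.evalPlace (Fp L) L (IsCMField.complexConj L) (2 + 2) (hermD L e dV hdV dW hdW) v.1
                (UnitaryGroup.finPart (Fp L) L (IsCMField.complexConj L) (2 + 2) (hermD L e dV hdV dW hdW) h))) (νv v.1)) :
    ∀ (S : skewMatrices ((IsCMField.complexConj L : L ≃ₐ[Fp L] L) : L →+* L) ((gramR L e dV hdV dW hdW).map (algebraMap (Fp L) L))) (h : HA L e dV hdV dW hdW) (s : ℂ) (j : Fin m),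
      ((2 : ℕ) : ℝ) / 2 < s.re → (S : Matrix (Fin 2) (Fin 2) L).det ≠ 0 →
      Integrable (fun p : ↥(unipDeltaArch L e dV hdV dW hdW) × (Π v : (kindWFinset L e dV hdV dW hdW T₀ (S : Matrix (Fin 2) (Fin 2) L) h), ↥(unipDeltaLoc L e dV hdV dW hdW v.1)) =>
      (conj (unipDeltaChar L e dV hdV dW hdW (S : Matrix (Fin 2) (Fin 2) L)
            (UnitaryGroup.archToAdelic (Fp L) L (IsCMField.complexConj L) (2 + 2) (hermD L e dV hdV dW hdW)
              (p.1 : UnitaryGroup.arch (Fp L) L (IsCMField.complexConj L) (2 + 2) (hermD L e dV hdV dW hdW))) : ℂ) *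
          ∏ v : (kindWFinset L e dV hdV dW hdW T₀ (S : Matrix (Fin 2) (Fin 2) L) h), conj (unipDeltaChar L e dV hdV dW hdW (S : Matrix (Fin 2) (Fin 2) L)
            (locToAdelic L e dV hdV dW hdW v.1
              ((p.2 v : ↥(unipDeltaLoc L e dV hdV dW hdW v.1)) : UnitaryGroup.localPi L (IsCMField.complexConj L) (2 + 2) (hermD L e dV hdV dW hdW) v.1)) : ℂ)) *
        (FinfT j S h s (UnitaryGroup.archPart (Fp L) L (IsCMField.complexConj L) (2 + 2) (hermD L e dV hdV dW hdW) (SiegelDoubled.weylDelta L e dV hdV dW hdW) *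
              (p.1 : UnitaryGroup.arch (Fp L) L (IsCMField.complexConj L) (2 + 2) (hermD L e dV hdV dW hdW)) *
              UnitaryGroup.archPart (Fp L) L (IsCMField.complexConj L) (2 + 2) (hermD L e dV hdV dW hdW) h) *
          ∏ v : (kindWFinset L e dV hdV dW hdW T₀ (S : Matrix (Fin 2) (Fin 2) L) h), FvT j S h v s (UnitaryGroup.evalPlace (Fp L) L (IsCMField.complexConj L) (2 + 2) (hermD L e dV hdV dW hdW) v.1
                (UnitaryGroup.finPart (Fp L) L (IsCMField.complexConj L) (2 + 2) (hermD L e dV hdV dW hdW) (SiegelDoubled.weylDelta L e dV hdV dW hdW)) *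
              ((p.2 v : ↥(unipDeltaLoc L e dV hdV dW hdW v.1)) : UnitaryGroup.localPi L (IsCMField.complexConj L) (2 + 2) (hermD L e dV hdV dW hdW) v.1) *
              UnitaryGroup.evalPlace (Fp L) L (IsCMField.complexConj L) (2 + 2) (hermD L e dV hdV dW hdW) v.1
                (UnitaryGroup.finPart (Fp L) L (IsCMField.complexConj L) (2 + 2) (hermD L e dV hdV dW hdW) h))))
        ((νinf (kindWFinset L e dV hdV dW hdW T₀ (S : Matrix (Fin 2) (Fin 2) L) h)).prod
          (Measure.pi fun v : (kindWFinset L e dV hdV dW hdW T₀ (S : Matrix (Fin 2) (Fin 2) L) h) => νv v.1)) := by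
  intro S h s j hs hdet
  exact integrable_tensor_prod_pi (νinf (kindWFinset L e dV hdV dW hdW T₀ (S : Matrix (Fin 2) (Fin 2) L) h))
    (fun v : (kindWFinset L e dV hdV dW hdW T₀ (S : Matrix (Fin 2) (Fin 2) L) h) => νv v.1)
    (fun a : ↥(unipDeltaArch L e dV hdV dW hdW) => conj (unipDeltaChar L e dV hdV dW hdW (S : Matrix (Fin 2) (Fin 2) L)
      (UnitaryGroup.archToAdelic (Fp L) L (IsCMField.complexConj L) (2 + 2) (hermD L e dV hdV dW hdW)
        (a : UnitaryGroup.arch (Fp L) L (IsCMField.complexConj L) (2 + 2) (hermD L e dV hdV dW hdW))) : ℂ))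
    (fun a : ↥(unipDeltaArch L e dV hdV dW hdW) => FinfT j S h s (UnitaryGroup.archPart (Fp L) L (IsCMField.complexConj L) (2 + 2) (hermD L e dV hdV dW hdW) (SiegelDoubled.weylDelta L e dV hdV dW hdW) *
      (a : UnitaryGroup.arch (Fp L) L (IsCMField.complexConj L) (2 + 2) (hermD L e dV hdV dW hdW)) * UnitaryGroup.archPart (Fp L) L (IsCMField.complexConj L) (2 + 2) (hermD L e dV hdV dW hdW) h))
    (fun v (y : ↥(unipDeltaLoc L e dV hdV dW hdW v.1)) => conj (unipDeltaChar L e dV hdV dW hdW (S : Matrix (Fin 2) (Fin 2) L)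
      (locToAdelic L e dV hdV dW hdW v.1 (y : UnitaryGroup.localPi L (IsCMField.complexConj L) (2 + 2) (hermD L e dV hdV dW hdW) v.1)) : ℂ))
    (fun v (y : ↥(unipDeltaLoc L e dV hdV dW hdW v.1)) => FvT j S h v s (UnitaryGroup.evalPlace (Fp L) L (IsCMField.complexConj L) (2 + 2) (hermD L e dV hdV dW hdW) v.1
        (UnitaryGroup.finPart (Fp L) L (IsCMField.complexConj L) (2 + 2) (hermD L e dV hdV dW hdW) (SiegelDoubled.weylDelta L e dV hdV dW hdW)) *
      (y : UnitaryGroup.localPi L (IsCMField.complexConj L) (2 + 2) (hermD L e dV hdV dW hdW) v.1) *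
      UnitaryGroup.evalPlace (Fp L) L (IsCMField.complexConj L) (2 + 2) (hermD L e dV hdV dW hdW) v.1 (UnitaryGroup.finPart (Fp L) L (IsCMField.complexConj L) (2 + 2) (hermD L e dV hdV dW hdW) h)))
    (hintArch S h s j hs hdet) (fun v => hintLoc j S h v s hs hdet)

end Head

/-! ## §3 The joint letter with the per-place side discharged by ★ (iii-fin-int) -/

section Joint

variable (L : Type) [Field L] [NumberField L] [IsCMField L]
variable {N M : ℕ} (e : Fin N × Fin M ≃ Fin 2)
  (dV : Fin N → L) (hdV : ∀ i, IsCMField.complexConj L (dV i) = dV i)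
  (dW : Fin M → L) (hdW : ∀ i, IsCMField.complexConj L (dW i) = dW i)
  (hdV0 : ∀ i, dV i ≠ 0) (hdW0 : ∀ i, dW i ≠ 0)
  [MeasurableSpace ↥(unipDeltaArch L e dV hdV dW hdW)]
  [∀ v : HeightOneSpectrum (𝓞 (Fp L)), MeasurableSpace ↥(unipDeltaLoc L e dV hdV dW hdW v)]
  [∀ v : HeightOneSpectrum (𝓞 (Fp L)), BorelSpace ↥(unipDeltaLoc L e dV hdV dW hdW v)]

include hdV0 hdW0 in
/-- **THE JOINT LETTER `hint` OF ★ (x-a) ED. 4 (`n := 2`) FROM THE ARCHIMEDEAN FACTOR LETTER AND SMOOTH LOCAL SIEGEL FACTORS**: §2 with `hintLoc :=` ★ (iii-fin-int)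
`hint_of_isLocalSiegelSection` — residue: `hintArch` (by value), the per-factor letters `hsec`, `hsm` of the local factors `FvT` ((KW-fac)), `χ` unitary (`hχu`; TOP: ★
`isUnitary_toHeckeCharacter`), Haar carriers `νv`. [cite: KudlaRallis1994, §1] [cite: Tan1999, §3] [cite: Folland1995, §2.3] -/
theorem hint_of_isLocalSiegelSection_joint (T₀ : Finset (HeightOneSpectrum (𝓞 (Fp L))))
    (νinf : Finset (HeightOneSpectrum (𝓞 (Fp L))) → Measure ↥(unipDeltaArch L e dV hdV dW hdW))
    (νv : ∀ v : HeightOneSpectrum (𝓞 (Fp L)), Measure ↥(unipDeltaLoc L e dV hdV dW hdW v)) [∀ v, (νv v).IsHaarMeasure] [∀ v, SigmaFinite (νv v)]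
    {χ : HeckeCharacter L} (hχu : χ.IsUnitary) {m : ℕ}
    (FinfT : Fin m → skewMatrices ((IsCMField.complexConj L : L ≃ₐ[Fp L] L) : L →+* L) ((gramR L e dV hdV dW hdW).map (algebraMap (Fp L) L)) → HA L e dV hdV dW hdW → ℂ →
      UnitaryGroup.arch (Fp L) L (IsCMField.complexConj L) (2 + 2) (hermD L e dV hdV dW hdW) → ℂ)
    (FvT : Fin m → ∀ (S : skewMatrices ((IsCMField.complexConj L : L ≃ₐ[Fp L] L) : L →+* L) ((gramR L e dV hdV dW hdW).map (algebraMap (Fp L) L)))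
      (h : HA L e dV hdV dW hdW) (v : (kindWFinset L e dV hdV dW hdW T₀ (S : Matrix (Fin 2) (Fin 2) L) h)),
      ℂ → UnitaryGroup.localPi L (IsCMField.complexConj L) (2 + 2) (hermD L e dV hdV dW hdW) v.1 → ℂ)
    (hintArch : ∀ (S : skewMatrices ((IsCMField.complexConj L : L ≃ₐ[Fp L] L) : L →+* L) ((gramR L e dV hdV dW hdW).map (algebraMap (Fp L) L))) (h : HA L e dV hdV dW hdW)
      (s : ℂ) (j : Fin m), ((2 : ℕ) : ℝ) / 2 < s.re → (S : Matrix (Fin 2) (Fin 2) L).det ≠ 0 →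
      Integrable (fun a : ↥(unipDeltaArch L e dV hdV dW hdW) =>
        conj (unipDeltaChar L e dV hdV dW hdW (S : Matrix (Fin 2) (Fin 2) L)
            (UnitaryGroup.archToAdelic (Fp L) L (IsCMField.complexConj L) (2 + 2) (hermD L e dV hdV dW hdW)
              (a : UnitaryGroup.arch (Fp L) L (IsCMField.complexConj L) (2 + 2) (hermD L e dV hdV dW hdW))) : ℂ) *
          FinfT j S h s (UnitaryGroup.archPart (Fp L) L (IsCMField.complexConj L) (2 + 2) (hermD L e dV hdV dW hdW) (SiegelDoubled.weylDelta L e dV hdV dW hdW) *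
              (a : UnitaryGroup.arch (Fp L) L (IsCMField.complexConj L) (2 + 2) (hermD L e dV hdV dW hdW)) *
              UnitaryGroup.archPart (Fp L) L (IsCMField.complexConj L) (2 + 2) (hermD L e dV hdV dW hdW) h))
        (νinf (kindWFinset L e dV hdV dW hdW T₀ (S : Matrix (Fin 2) (Fin 2) L) h)))
    (hsec : haveI : Algebra.IsQuadraticExtension (Fp L) L := IsCMField.isQuadraticExtension L
      ∀ (j : Fin m) (S : skewMatrices ((IsCMField.complexConj L : L ≃ₐ[Fp L] L) : L →+* L) ((gramR L e dV hdV dW hdW).map (algebraMap (Fp L) L)))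
      (h : HA L e dV hdV dW hdW) (v : (kindWFinset L e dV hdV dW hdW T₀ (S : Matrix (Fin 2) (Fin 2) L) h)) (s : ℂ), ((2 : ℕ) : ℝ) / 2 < s.re → (S : Matrix (Fin 2) (Fin 2) L).det ≠ 0 →
      IsLocalSiegelSection (Fp L) L (IsCMField.complexConj L) (complexConj_imagUnit L) (imagUnit_ne_zero L) (imagUnit_mul_self L) v.1 2
        (gramR_isSymm L e dV hdV dW hdW) (hermD_eq_map_gramD L e dV hdV dW hdW) (fun w => χ.localComponent w.1) s (FvT j S h v s))
    (hsm : ∀ (j : Fin m) (S : skewMatrices ((IsCMField.complexConj L : L ≃ₐ[Fp L] L) : L →+* L) ((gramR L e dV hdV dW hdW).map (algebraMap (Fp L) L)))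
      (h : HA L e dV hdV dW hdW) (v : (kindWFinset L e dV hdV dW hdW T₀ (S : Matrix (Fin 2) (Fin 2) L) h)) (s : ℂ), ((2 : ℕ) : ℝ) / 2 < s.re → (S : Matrix (Fin 2) (Fin 2) L).det ≠ 0 →
      IsSmooth (Fp L) L (IsCMField.complexConj L) v.1 2 (JD := hermD L e dV hdV dW hdW) (FvT j S h v s)) :
    ∀ (S : skewMatrices ((IsCMField.complexConj L : L ≃ₐ[Fp L] L) : L →+* L) ((gramR L e dV hdV dW hdW).map (algebraMap (Fp L) L))) (h : HA L e dV hdV dW hdW) (s : ℂ) (j : Fin m),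
      ((2 : ℕ) : ℝ) / 2 < s.re → (S : Matrix (Fin 2) (Fin 2) L).det ≠ 0 →
      Integrable (fun p : ↥(unipDeltaArch L e dV hdV dW hdW) × (Π v : (kindWFinset L e dV hdV dW hdW T₀ (S : Matrix (Fin 2) (Fin 2) L) h), ↥(unipDeltaLoc L e dV hdV dW hdW v.1)) =>
      (conj (unipDeltaChar L e dV hdV dW hdW (S : Matrix (Fin 2) (Fin 2) L)
            (UnitaryGroup.archToAdelic (Fp L) L (IsCMField.complexConj L) (2 + 2) (hermD L e dV hdV dW hdW)
              (p.1 : UnitaryGroup.arch (Fp L) L (IsCMField.complexConj L) (2 + 2) (hermD L e dV hdV dW hdW))) : ℂ) *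
          ∏ v : (kindWFinset L e dV hdV dW hdW T₀ (S : Matrix (Fin 2) (Fin 2) L) h), conj (unipDeltaChar L e dV hdV dW hdW (S : Matrix (Fin 2) (Fin 2) L)
            (locToAdelic L e dV hdV dW hdW v.1
              ((p.2 v : ↥(unipDeltaLoc L e dV hdV dW hdW v.1)) : UnitaryGroup.localPi L (IsCMField.complexConj L) (2 + 2) (hermD L e dV hdV dW hdW) v.1)) : ℂ)) *
        (FinfT j S h s (UnitaryGroup.archPart (Fp L) L (IsCMField.complexConj L) (2 + 2) (hermD L e dV hdV dW hdW) (SiegelDoubled.weylDelta L e dV hdV dW hdW) *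
              (p.1 : UnitaryGroup.arch (Fp L) L (IsCMField.complexConj L) (2 + 2) (hermD L e dV hdV dW hdW)) *
              UnitaryGroup.archPart (Fp L) L (IsCMField.complexConj L) (2 + 2) (hermD L e dV hdV dW hdW) h) *
          ∏ v : (kindWFinset L e dV hdV dW hdW T₀ (S : Matrix (Fin 2) (Fin 2) L) h), FvT j S h v s (UnitaryGroup.evalPlace (Fp L) L (IsCMField.complexConj L) (2 + 2) (hermD L e dV hdV dW hdW) v.1
                (UnitaryGroup.finPart (Fp L) L (IsCMField.complexConj L) (2 + 2) (hermD L e dV hdV dW hdW) (SiegelDoubled.weylDelta L e dV hdV dW hdW)) *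
              ((p.2 v : ↥(unipDeltaLoc L e dV hdV dW hdW v.1)) : UnitaryGroup.localPi L (IsCMField.complexConj L) (2 + 2) (hermD L e dV hdV dW hdW) v.1) *
              UnitaryGroup.evalPlace (Fp L) L (IsCMField.complexConj L) (2 + 2) (hermD L e dV hdV dW hdW) v.1
                (UnitaryGroup.finPart (Fp L) L (IsCMField.complexConj L) (2 + 2) (hermD L e dV hdV dW hdW) h))))
        ((νinf (kindWFinset L e dV hdV dW hdW T₀ (S : Matrix (Fin 2) (Fin 2) L) h)).prod
          (Measure.pi fun v : (kindWFinset L e dV hdV dW hdW T₀ (S : Matrix (Fin 2) (Fin 2) L) h) => νv v.1)) :=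
  hint_of_factorIntegrable L e dV hdV dW hdW T₀ νinf νv FinfT FvT hintArch
    (hint_of_isLocalSiegelSection L e dV hdV dW hdW hdV0 hdW0 T₀ νv hχu FvT hsec hsm)

end Joint

end Summit.HodgeConjecture.HodgeConjecture.Cruxes.HLiu418.K2LiuKindWJointIntegrable

end
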